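import Summits.BirchSwinnertonDyer.BirchSwinnertonDyer.Theorems.SignedLowerHalvesSmallImageLowerHalfBothSignsRttD2SeqJ3LambdaPairing
import Literature.NumberTheory.EllipticCurves.PadicCoeffIntegersFrobeniusData
import Literature.NumberTheory.EllipticCurves.GreenbergSelmerCharIdealPrincipalProofs
import HarnessLib

/-!
# Route `SignedLowerHalves`, crux L `SmallImageLowerHalfBothSigns` (stmt-BirchSwinnertonDyer-23599), line `rtt_w3` v22 — E2, row J3: ★★★ A PERFECT `λ` EXISTS —
# the `λ`-perfectness inputs `hlamInj` / `hlamSurj` of S2 (`exact_junctionMap_comp_subtype_cofree_lam_of_lamPerfect`, H7f) hold for SOME `ℤ_p`-linear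
# `λ : 𝒪 → ℤ_p` on `𝒪 = padicCoeffIntegers S` (`[ℚ_p(S):ℚ_p] < ∞`)

WIDTH seat `bsd-line-slh-p3-w3` g24 under LEAD `cruxlead-stmt-BirchSwinnertonDyer-23599` g12 (cell `bsd-ssimc`); helper `--supports stmt-BirchSwinnertonDyer-23599` (brick BOOKED
by the LEAD, bus 02:49Z). THEOREMS ONLY (no definition, no named fact, no instance, no `sorry`). HONEST FRAMING: `𝒪` is a FROBENIUS `ℤ_p`-algebra — the tree's
`exists_frobeniusData_unitBall` (cell `bsd-stepL`: the codifferent of the PID `𝒪_E` is principal, Serre *Local Fields* III §3) gives a `ℤ_p`-linear form `t` with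
mutually `t`-dual bases `b`, `b′`; transported along `padicCoeffIntegers S = unitBall p ℚ_p(S)` (same elements of `ℚ̄_p`) this `t` is the `λ` of the junction:
`y = Σ t(y bᵢ) b′ᵢ` makes `t(· y) ≡ 0 (p^m) ⇒ y ∈ p^m𝒪`, and `y := Σ ℓ(g bᵢ) b′ᵢ` solves `g = t(· y) mod p^m` for any additive `g : 𝒪 → ℤ/p^m` (additive maps into `ℤ/p^m`
are automatically `ℤ_p`-semilinear). With H7f, S2 for `M = Cofree θ F` then has NO hypothesis beyond the frame (next file assembles). E2, crux L, crux M, BSD remain OPEN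
and are proved for NO curve.

* `addMonoidHom_map_smul_eq_toZModPow_mul` — `g (c • z) = (c mod p^m) · g z` for additive `g : B → ℤ/p^m` on a `ℤ_p`-algebra `B`;
* `mem_span_pow_of_forall_frobenius`, `exists_forall_eq_toZModPow_frobenius` — injectivity / surjectivity mod `p^m` from Frobenius data (any `ℤ_p`-algebra);
* ★★★ `exists_lam_perfect` — `∃ lam : 𝒪 →+ ℤ_[p], hlam ∧ (∀ m, hlamInj m) ∧ (∀ m, hlamSurj m)` for `𝒪 = padicCoeffIntegers S`.
References: [SerreLocalFields1979] Ch. III §3, §2 Prop. 4; [NeukirchANT1999] Ch. II (4.8); [Rubin2000] §4.2; [NeukirchSchmidtWingberg2008] (7.2.6).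
-/

set_option autoImplicit false
set_option linter.dupNamespace false -- D-0017: single-problem summit, the namespace repeats the problem name by design
noncomputable section

open scoped Classical
open NumberField IsDedekindDomain Field Function

namespace Summit.BirchSwinnertonDyer.BirchSwinnertonDyer.Theorems.SmallImageRttD2Seq

open Literature.NumberTheory.EllipticCurves Literature.NumberTheory.Automorphic

/-! ## §1. Frobenius data over `ℤ_p` give perfectness modulo every `p^m` -/

section Frobenius

variable {p : ℕ} [Fact p.Prime] {B : Type*} [CommRing B] [Algebra ℤ_[p] B]

/-- **Additive maps into `ℤ/p^m` are `ℤ_p`-semilinear**: `g (c • z) = (c mod p^m) · g z` — write `c = n + p^m c′` with `n = (c mod p^m).val`.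
[cite: NeukirchANT1999, Ch. II (4.8)] [folklore] -/
theorem addMonoidHom_map_smul_eq_toZModPow_mul (m : ℕ) (g : B →+ ZMod (p ^ m)) (c : ℤ_[p]) (z : B) :
    g (c • z) = PadicInt.toZModPow m c * g z := by
  haveI : NeZero (p ^ m) := ⟨pow_ne_zero _ (Fact.out : p.Prime).ne_zero⟩
  -- `c - n ∈ ker (toZModPow m) = (p^m)`
  have hker : c - ((PadicInt.toZModPow m c).val : ℤ_[p]) ∈ RingHom.ker (PadicInt.toZModPow (p := p) m) := by
    rw [RingHom.mem_ker, map_sub, map_natCast, ZMod.natCast_zmod_val, sub_self]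
  rw [PadicInt.ker_toZModPow, Ideal.mem_span_singleton'] at hker
  obtain ⟨c', hc'⟩ := hker
  have hc : c = ((PadicInt.toZModPow m c).val : ℤ_[p]) + c' * (p : ℤ_[p]) ^ m := by rw [hc']; ring
  have h1 : g ((((PadicInt.toZModPow m c).val : ℤ_[p])) • z) = PadicInt.toZModPow m c * g z := by
    rw [Nat.cast_smul_eq_nsmul, map_nsmul, nsmul_eq_mul, ZMod.natCast_zmod_val]
  have h2 : g ((c' * (p : ℤ_[p]) ^ m) • z) = 0 := by
    rw [mul_comm, mul_smul, ← Nat.cast_pow, Nat.cast_smul_eq_nsmul, map_nsmul, nsmul_eq_mul, ZMod.natCast_self, zero_mul]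
  conv_lhs => rw [hc]
  rw [add_smul, map_add, h1, h2, add_zero]

variable {n : ℕ} (t : B →ₗ[ℤ_[p]] ℤ_[p]) (b b' : Fin n → B)
  (hb : ∀ a : B, a = ∑ i, t (a * b' i) • b i) (hb' : ∀ a : B, a = ∑ i, t (a * b i) • b' i)

include hb' in
/-- **Non-degeneracy mod `p^m` from Frobenius data**: if `t(x y) ∈ p^m ℤ_p` for all `x`, then `y = Σ t(y bᵢ) b′ᵢ ∈ p^m B`. [cite: SerreLocalFields1979, Ch. III §3] -/
theorem mem_span_pow_of_forall_frobenius (m : ℕ) (y : B) (hy : ∀ x : B, t (x * y) ∈ Ideal.span {(p : ℤ_[p]) ^ m}) :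
    y ∈ Ideal.span {((p : ℕ) : B) ^ m} := by
  choose q hq using fun i ↦ Ideal.mem_span_singleton'.mp (hy (b i))
  rw [Ideal.mem_span_singleton']
  refine ⟨∑ i, q i • b' i, ?_⟩
  conv_rhs => rw [hb' y]
  rw [Finset.sum_mul]
  refine Finset.sum_congr rfl fun i _ ↦ ?_
  rw [mul_comm y, ← hq i, mul_smul, smul_mul_assoc, Algebra.smul_def ((p : ℤ_[p]) ^ m), map_pow, map_natCast, mul_comm]

include hb in
/-- **Perfectness mod `p^m` from Frobenius data**: every additive `g : B → ℤ/p^m` is `x ↦ t(x y) mod p^m` for `y := Σ ℓ(g bᵢ) b′ᵢ` (`ℓ` any section of `ℤ_p → ℤ/p^m`).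
[cite: SerreLocalFields1979, Ch. III §3, §2 Prop. 4] -/
theorem exists_forall_eq_toZModPow_frobenius (m : ℕ) (g : B →+ ZMod (p ^ m)) :
    ∃ y : B, ∀ x : B, g x = PadicInt.toZModPow m (t (x * y)) := by
  haveI : NeZero (p ^ m) := ⟨pow_ne_zero _ (Fact.out : p.Prime).ne_zero⟩
  refine ⟨∑ i, ((g (b i)).val : ℤ_[p]) • b' i, fun x ↦ ?_⟩
  have hval : ∀ i, PadicInt.toZModPow m (((g (b i)).val : ℤ_[p])) = g (b i) := fun i ↦ by
    rw [map_natCast, ZMod.natCast_zmod_val]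
  -- the right-hand side
  rw [Finset.mul_sum, map_sum, map_sum]
  simp_rw [mul_smul_comm, map_smul, smul_eq_mul, map_mul, hval]
  -- the left-hand side: expand `x` in the basis `b`
  conv_lhs => rw [hb x, map_sum]
  refine Finset.sum_congr rfl fun i _ ↦ ?_
  rw [addMonoidHom_map_smul_eq_toZModPow_mul, mul_comm]

end Frobenius

/-! ## §2. A perfect `λ` on `𝒪 = padicCoeffIntegers S` -/

section Lam

variable {p : ℕ} [Fact p.Prime] (S : Set (PadicAlgCl p)) [FiniteDimensional ℚ_[p] (padicCoeffField S)]

/-- ★★★ **A PERFECT `λ` EXISTS.** For `𝒪 = padicCoeffIntegers S` with `[ℚ_p(S):ℚ_p] < ∞` there is an additive, `ℤ_p`-linear `lam : 𝒪 → ℤ_p` whose reduction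
`λ mod p^m` (`lamZMod S lam m`) is PERFECT at every level: `λ(b t) ≡ 0 ∀ b ⇒ t ∈ p^m𝒪` (`hlamInj`) and every additive `g : 𝒪 → ℤ/p^m` is `b ↦ λ(b t) mod p^m`
(`hlamSurj`) — the hypotheses of `exact_junctionMap_comp_subtype_cofree_lam_of_lamPerfect` (H7f). Proof: Frobenius data on `unitBall p ℚ_p(S)` (tree
`exists_frobeniusData_unitBall`: the codifferent of a PID is principal), §1, and transport along `padicCoeffIntegers S = unitBall p ℚ_p(S)` (same elements of `ℚ̄_p`).
[cite: SerreLocalFields1979, Ch. III §3, §2 Prop. 4] [cite: NeukirchANT1999, Ch. II (4.8)] [cite: Rubin2000, §4.2] -/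
theorem exists_lam_perfect :
    ∃ lam : padicCoeffIntegers S →+ ℤ_[p],
      (∀ (c : ℤ_[p]) (y : padicCoeffIntegers S), lam (padicIntToCoeffIntegers S c * y) = c * lam y) ∧
      (∀ (m : ℕ) (t : padicCoeffIntegers S), (∀ b : padicCoeffIntegers S, lamZMod S lam m (b * t) = 0) →
        t ∈ Ideal.span {((p : ℕ) : padicCoeffIntegers S) ^ m}) ∧
      (∀ (m : ℕ) (g : padicCoeffIntegers S →+ ZMod (p ^ m)), ∃ t : padicCoeffIntegers S,
        ∀ b : padicCoeffIntegers S, g b = lamZMod S lam m (b * t)) := by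
  let E := padicCoeffField S
  -- Frobenius data on the unit ball of `E = ℚ_p(S)`
  obtain ⟨n, t, b, b', hb, hb'⟩ := exists_frobeniusData_unitBall p E
  -- `𝒪 = unitBall p E` (same elements of `ℚ̄_p`)
  let eR : padicCoeffIntegers S ≃+* PadicIntermediateField.unitBall p E := RingEquiv.subringCongr (padicCoeffIntegers_eq_unitBall S)
  have heR : ∀ c : ℤ_[p], eR (padicIntToCoeffIntegers S c) = algebraMap ℤ_[p] (PadicIntermediateField.unitBall p E) c := by
    intro c
    apply Subtype.ext
    change algebraMap ℚ_[p] (PadicAlgCl p) (c : ℚ_[p]) = algebraMap ℤ_[p] (PadicAlgCl p) c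
    rw [IsScalarTower.algebraMap_apply ℤ_[p] ℚ_[p] (PadicAlgCl p)]
    rfl
  refine ⟨t.toAddMonoidHom.comp eR.toAddMonoidHom, fun c y ↦ ?_, fun m t₀ ht₀ ↦ ?_, fun m g ↦ ?_⟩
  · -- `ℤ_p`-linearity
    change t (eR (padicIntToCoeffIntegers S c * y)) = c * t (eR y)
    rw [map_mul eR, heR, ← Algebra.smul_def, map_smul, smul_eq_mul]
  · -- `hlamInj`
    have hy : ∀ x : PadicIntermediateField.unitBall p E, t (x * eR t₀) ∈ Ideal.span {(p : ℤ_[p]) ^ m} := by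
      intro x
      have h := ht₀ (eR.symm x)
      rw [lamZMod_apply] at h
      change PadicInt.toZModPow m (t (eR (eR.symm x * t₀))) = 0 at h
      rw [map_mul eR, RingEquiv.apply_symm_apply] at h
      rw [← PadicInt.ker_toZModPow, RingHom.mem_ker]
      exact h
    have hmem := mem_span_pow_of_forall_frobenius t b b' hb' m (eR t₀) hy
    rw [Ideal.mem_span_singleton'] at hmem ⊢
    obtain ⟨z, hz⟩ := hmem
    refine ⟨eR.symm z, eR.injective ?_⟩
    rw [map_mul eR, RingEquiv.apply_symm_apply, map_pow, map_natCast, hz]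
  · -- `hlamSurj`
    obtain ⟨y, hy⟩ := exists_forall_eq_toZModPow_frobenius t b b' hb m (g.comp eR.symm.toAddMonoidHom)
    refine ⟨eR.symm y, fun x ↦ ?_⟩
    have h := hy (eR x)
    change g (eR.symm (eR x)) = _ at h
    rw [RingEquiv.symm_apply_apply] at h
    rw [h, lamZMod_apply]
    change _ = PadicInt.toZModPow m (t (eR (x * eR.symm y)))
    rw [map_mul eR, RingEquiv.apply_symm_apply]

end Lam

end Summit.BirchSwinnertonDyer.BirchSwinnertonDyer.Theorems.SmallImageRttD2Seq

end
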